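import Literature.MathematicalPhysics.QuantumFieldTheory.Balaban1983to89.B16Ineq17NearFlatOneSided

/-!
# `Balaban1983to89.B16Ineq17NearFlatOneSidedSeminorm` — [Balaban1989LargeFieldII] (1.7) pp. 357–358 at a near-flat background, one-sided (sequel of
# `B16Ineq17NearFlatOneSided`): the SAME skeleton with every size measured by ARBITRARY SEMINORMS `p` on the configuration chart space and `q` on
# the datum chart space — so that the `ℓ²` letters of the tree (dag-n12-w2's `Σ_b ‖X_b‖²` second-variation bounds, the `PiLp 2` norm of dag-n12-c's
# `GaugeSlice`) enter WITHOUT transporting dag-n12-w3's calculus off the Pi types on which the Wilson action and the averaging are typed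
# (word of the N12 lane owner dag-n12-c, 2026-08-28 01:52Z: «(ii) ℓ² — instantiate … on the ℓ² space the letter lives on»)

statement-level skeleton of published theorems with citation tags; proofs where landed; nothing here is a claim about
the Yang–Mills mass gap.

T. Bałaban, *Large field renormalization. II*, Commun. Math. Phys. **122** (1989) 355–392 [Balaban1989LargeFieldII], p. 357, (1.7) p. 358, (1.12) p. 359;
T. Bałaban, Commun. Math. Phys. **102** (1985) 277–309 [Balaban1985Variational], (36)–(47) pp. 283–285, (82)–(83) p. 290, (172)–(177) pp. 305–306;
T. Bałaban, Commun. Math. Phys. **95** (1984) 17–40 [Balaban1984PropagatorsI], (1.64)–(1.67) p. 29; T. Bałaban, Commun. Math. Phys. **99** (1985) 389–434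
[Balaban1985BackgroundPropagators], (3.10) p. 392.

Cell pub-ymgap, HUMAN RULING D-0062 ∕ D-0149, seat `pub-ymgap-dag-n12-w4` g2 (WIDTH SEAT 4 of DAG node N12 = [B15]; key K1⁷ stmt-QuantumFields-20542, helper,
count-neutral).  CONSUMED BY NAME: this seat's `B16Ineq17NearFlatOneSided.fibreTransfer_constraint` (p593499); dag-n12-w3's
`B11Eq177CriticalFamilyDerivative.hessian_value_criticalFamily` (p584027) — an IDENTITY, norm-free, which is why the seminorms can be chosen freely.

WHY.  The prequel measures the letters (δ₁)(μ)(δ₂)(β)(K)(ρ) in the instance norms of `E` and `V`.  At the record, `E` = the Pi type `PBond P k → 𝔰𝔲(2)` (sup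
norm) on which `wilsonAction4 ∘ expChart U₀` and the averaging chart are typed and differentiated (dag-n12-w3 §2), whereas the second-variation letters
(dag-n12-w2, p587195 ∕ p593907) are sums `Σ_b‖X_b‖²` — the square of the `ℓ²` SEMINORM of the Pi type — and the consumer's `Cerr‖X‖²` is the `PiLp 2`
norm of the slice.  Measuring with a sup norm would cost a volume factor `#bonds`; measuring with `p = ℓ²` costs nothing.  The proofs of the prequel use
of `‖·‖` only sub-additivity, absolute homogeneity and non-negativity on `E`, and NOTHING on `V` (the datum sizes only ever appear inside the letters),
so they go through for a `Seminorm ℝ E` and an arbitrary function `q : V → ℝ`.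

WHAT THIS FILE PROVES (THEOREMS ONLY — no `def`, no `sorry`; axioms standard).
§1 `seminorm_fibreTransfer_sub_le` (`p(w′ − w) ≤ ρδ₂·p(w)`), `abs_bilin_diag_sub_le_seminorm`, ★★ `secondVariation_ge_flatMin_sub_seminorm`
   (`m − (δ₁ + βρδ₂(2 + ρδ₂))·p(w)² ≤ A`), ★★ `lagrangeHessian_ge_flatMin_sub_seminorm` (`m − (δ₁ + μ + βρδ₂(2 + ρδ₂))·p(w)² ≤ A − ℓ`),
   `lagrangeHessian_ge_flatMin_sub_seminorm_of_le` (with (K) `p(w) ≤ K·r` for any datum size `r ≥ 0`: `m − Cerr·r² ≤ A − ℓ`, `Cerr = (…)·K²`),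
   `abs_multiplier_apply_le_seminorm` (`|λ₀ v| ≤ jρ·q(v)` from `|φ x| ≤ j·p(x)`, `p(Rv) ≤ ρ·q(v)`).
§2 `le_zero_of_forall_le_div_sq` (bookkeeping: `x ≤ c∕t²` for all `t > 0` forces `x ≤ 0`), ★ `abs_bilin_le_of_symm_of_diag_seminorm` (POLARISATION for a
   seminorm: symmetric `B` with `|B(w,w)| ≤ β′·p(w)²` has `|B(u,v)| ≤ 2β′·p(u)·p(v)`, degenerate directions included).
§3 ★★ `hessian_value_criticalFamily_ge_flatMin_sub_seminorm` (dag-n12-w3's (1.12) shape + affine datum ⇒ `m − (δ₁ + μ + βρδ₂(2 + ρδ₂))·p(γ′h)² ≤ D²(a∘γ)(g₀)[h,h]`),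
   `…_seminorm_of_section` (the implicit family parametrised by its datum, `Φ(γ g) = g`).

HONEST SCOPE.  Structure only; the letters stay DISPLAYED; nothing of Bałaban's asserted; count-neutral; N12 NOT discharged; K1⁷ NOT closed; one finite 𝕋⁴
programme at fixed `ε`; R4 closes the conditional finite-𝕋⁴ rung `BalabanLadder.UV` only — the Yang–Mills mass gap (Clay) is NOT proved by any of this; nothing
continuum ∕ ℝ⁴ ∕ OS.
-/

noncomputable section

open Filter Topology Set
open scoped Topology

namespace Literature.MathematicalPhysics.QuantumFieldTheory.Balaban1983to89.B16Ineq17NearFlatOneSidedSeminorm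

open B16Ineq17NearFlatOneSided (fibreTransfer_constraint)
open B11Eq177CriticalFamilyDerivative (hessian_value_criticalFamily)

/-! ## §1  The skeleton with seminorm sizes -/

section Algebra

variable {E V : Type*} [NormedAddCommGroup E] [NormedSpace ℝ E] [NormedAddCommGroup V] [NormedSpace ℝ V]

/-- **THE MOVE IS SMALL (seminorm sizes)**: `p(w′ − w) ≤ ρδ₂·p(w)` for `w′ = w + R♭(y − L♭w)`, `Lw = y`, with `p(R♭v) ≤ ρ·q(v)` and (δ₂) `q(Lw − L♭w) ≤ δ₂·p(w)`.
[cite: Balaban1989LargeFieldII, p.357; Balaban1985Variational, (36)–(37) p.283 (bookkeeping)] -/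
theorem seminorm_fibreTransfer_sub_le (p : Seminorm ℝ E) (q : V → ℝ) (L Lf : E →L[ℝ] V) {Rf : V → E} {ρ δ₂ : ℝ} (hρ0 : 0 ≤ ρ)
    (hρ : ∀ v, p (Rf v) ≤ ρ * q v) {w : E} {y : V} (hLw : L w = y) (hδ₂ : q (L w - Lf w) ≤ δ₂ * p w) :
    p ((w + Rf (y - Lf w)) - w) ≤ ρ * δ₂ * p w := by
  rw [add_sub_cancel_left, ← hLw]
  calc p (Rf (L w - Lf w)) ≤ ρ * q (L w - Lf w) := hρ _
    _ ≤ ρ * (δ₂ * p w) := mul_le_mul_of_nonneg_left hδ₂ hρ0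
    _ = ρ * δ₂ * p w := by ring

/-- **MOVING THE DIAGONAL (seminorm sizes)**: `|B(w′,w′) − B(w,w)| ≤ β·p(w′ − w)·(p(w′) + p(w))` for `|B(u,v)| ≤ β·p(u)·p(v)`.
[cite: Balaban1989LargeFieldII, (1.7) p.358 (bookkeeping)] -/
theorem abs_bilin_diag_sub_le_seminorm (p : Seminorm ℝ E) (B : E →L[ℝ] E →L[ℝ] ℝ) {β : ℝ} (hβ : ∀ u v, |B u v| ≤ β * p u * p v) (w w' : E) :
    |B w' w' - B w w| ≤ β * p (w' - w) * (p w' + p w) := by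
  have h : B w' w' - B w w = B (w' - w) w' + B w (w' - w) := by
    simp only [map_sub, sub_apply]
    ring
  rw [h]
  calc |B (w' - w) w' + B w (w' - w)| ≤ |B (w' - w) w'| + |B w (w' - w)| := abs_add_le _ _
    _ ≤ β * p (w' - w) * p w' + β * p w * p (w' - w) := add_le_add (hβ _ _) (hβ _ _)
    _ = β * p (w' - w) * (p w' + p w) := by ring

/-- ★★ **THE SECOND VARIATION AT THE NEAR-FLAT BACKGROUND DOMINATES THE FLAT EFFECTIVE FORM, ONE-SIDED — SEMINORM SIZES.**  As
`B16Ineq17NearFlatOneSided.secondVariation_ge_flatMin_sub` with every `‖·‖_E` replaced by a seminorm `p` (e.g. the `ℓ²` seminorm of the bond-field Pi type) and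
every `‖·‖_V` by an arbitrary size `q`: for every `m` dominated by `B♭` on the flat fibre of `y`, `m − (δ₁ + βρδ₂(2 + ρδ₂))·p(w)² ≤ A`.
[cite: Balaban1989LargeFieldII, (1.7) pp.357–358; Balaban1984PropagatorsI, (1.64)–(1.67) p.29] -/
theorem secondVariation_ge_flatMin_sub_seminorm (p : Seminorm ℝ E) (q : V → ℝ) (Bf : E →L[ℝ] E →L[ℝ] ℝ) (L Lf : E →L[ℝ] V) {Rf : V → E}
    {δ₁ β ρ δ₂ : ℝ} (hβ0 : 0 ≤ β) (hρ0 : 0 ≤ ρ)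
    (hβ : ∀ u v, |Bf u v| ≤ β * p u * p v) (hRf : ∀ v, Lf (Rf v) = v) (hρ : ∀ v, p (Rf v) ≤ ρ * q v)
    {w : E} {y : V} (hLw : L w = y) (hδ₂ : q (L w - Lf w) ≤ δ₂ * p w)
    {A : ℝ} (hδ₁ : Bf w w - δ₁ * p w ^ 2 ≤ A)
    {m : ℝ} (hm : ∀ w', Lf w' = y → m ≤ Bf w' w') :
    m - (δ₁ + β * (ρ * δ₂) * (2 + ρ * δ₂)) * p w ^ 2 ≤ A := by
  set w' : E := w + Rf (y - Lf w) with hw'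
  have hLf : Lf w' = y := fibreTransfer_constraint Lf hRf w y
  have he : p (w' - w) ≤ ρ * δ₂ * p w := seminorm_fibreTransfer_sub_le p q L Lf hρ0 hρ hLw hδ₂
  have hm' : m ≤ Bf w' w' := hm w' hLf
  have he0 : 0 ≤ p (w' - w) := apply_nonneg p _
  have hwn : 0 ≤ p w := apply_nonneg p _
  have hE0 : 0 ≤ ρ * δ₂ * p w := le_trans he0 he
  have hw'n : p w' ≤ p w + p (w' - w) := by
    calc p w' = p (w + (w' - w)) := by rw [add_sub_cancel]
      _ ≤ p w + p (w' - w) := map_add_le_add p _ _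
  have hbd : |Bf w' w' - Bf w w| ≤ β * (ρ * δ₂) * (2 + ρ * δ₂) * p w ^ 2 := by
    have h1 : β * p (w' - w) * (p w' + p w) ≤ β * p (w' - w) * (2 * p w + p (w' - w)) :=
      mul_le_mul_of_nonneg_left (by linarith) (mul_nonneg hβ0 he0)
    have h2 : β * p (w' - w) * (2 * p w + p (w' - w)) ≤ β * (ρ * δ₂ * p w) * (2 * p w + p (w' - w)) :=
      mul_le_mul_of_nonneg_right (mul_le_mul_of_nonneg_left he hβ0) (by positivity)
    have h3 : β * (ρ * δ₂ * p w) * (2 * p w + p (w' - w)) ≤ β * (ρ * δ₂ * p w) * (2 * p w + ρ * δ₂ * p w) :=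
      mul_le_mul_of_nonneg_left (by linarith) (mul_nonneg hβ0 hE0)
    have h4 : β * (ρ * δ₂ * p w) * (2 * p w + ρ * δ₂ * p w) = β * (ρ * δ₂) * (2 + ρ * δ₂) * p w ^ 2 := by ring
    calc |Bf w' w' - Bf w w| ≤ β * p (w' - w) * (p w' + p w) := abs_bilin_diag_sub_le_seminorm p Bf hβ w w'
      _ ≤ β * (ρ * δ₂) * (2 + ρ * δ₂) * p w ^ 2 := by linarith
  have hlow : Bf w' w' - β * (ρ * δ₂) * (2 + ρ * δ₂) * p w ^ 2 ≤ Bf w w := by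
    have := (abs_le.mp hbd).2
    linarith
  have key : (δ₁ + β * (ρ * δ₂) * (2 + ρ * δ₂)) * p w ^ 2
      = δ₁ * p w ^ 2 + β * (ρ * δ₂) * (2 + ρ * δ₂) * p w ^ 2 := by ring
  rw [key]
  linarith

/-- ★★ **THE LAGRANGIAN HESSIAN DOMINATES THE FLAT EFFECTIVE FORM, ONE-SIDED — SEMINORM SIZES**: with the multiplier letter (μ) `ℓ ≤ μ·p(w)²`,
`m − (δ₁ + μ + βρδ₂(2 + ρδ₂))·p(w)² ≤ A − ℓ`. [cite: Balaban1989LargeFieldII, (1.7) p.358, (1.12) p.359; Balaban1985Variational, (47) p.285] -/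
theorem lagrangeHessian_ge_flatMin_sub_seminorm (p : Seminorm ℝ E) (q : V → ℝ) (Bf : E →L[ℝ] E →L[ℝ] ℝ) (L Lf : E →L[ℝ] V) {Rf : V → E}
    {δ₁ μ β ρ δ₂ : ℝ} (hβ0 : 0 ≤ β) (hρ0 : 0 ≤ ρ)
    (hβ : ∀ u v, |Bf u v| ≤ β * p u * p v) (hRf : ∀ v, Lf (Rf v) = v) (hρ : ∀ v, p (Rf v) ≤ ρ * q v)
    {w : E} {y : V} (hLw : L w = y) (hδ₂ : q (L w - Lf w) ≤ δ₂ * p w)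
    {A ℓ : ℝ} (hδ₁ : Bf w w - δ₁ * p w ^ 2 ≤ A) (hμ : ℓ ≤ μ * p w ^ 2)
    {m : ℝ} (hm : ∀ w', Lf w' = y → m ≤ Bf w' w') :
    m - (δ₁ + μ + β * (ρ * δ₂) * (2 + ρ * δ₂)) * p w ^ 2 ≤ A - ℓ := by
  have h := secondVariation_ge_flatMin_sub_seminorm p q Bf L Lf hβ0 hρ0 hβ hRf hρ hLw hδ₂ hδ₁ hm
  have key : (δ₁ + μ + β * (ρ * δ₂) * (2 + ρ * δ₂)) * p w ^ 2
      = (δ₁ + β * (ρ * δ₂) * (2 + ρ * δ₂)) * p w ^ 2 + μ * p w ^ 2 := by ring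
  rw [key]
  linarith

/-- **THE SAME AGAINST ANY DATUM SIZE `r`** (letter (K) as `p(w) ≤ K·r` for any real `r` — e.g. `r = ‖X‖` the `PiLp 2` norm of the slice vector whose image is the
datum velocity): `m − Cerr·r² ≤ A − ℓ`, `Cerr = (δ₁ + μ + βρδ₂(2 + ρδ₂))·K²`. [cite: Balaban1989LargeFieldII, (1.7) pp.357–358; Balaban1989LargeFieldI, Prop. 1 (1.77)–(1.78) p.194] -/
theorem lagrangeHessian_ge_flatMin_sub_seminorm_of_le (p : Seminorm ℝ E) (q : V → ℝ) (Bf : E →L[ℝ] E →L[ℝ] ℝ) (L Lf : E →L[ℝ] V)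
    {Rf : V → E} {δ₁ μ β ρ δ₂ K r : ℝ} (hδ₁0 : 0 ≤ δ₁) (hμ0 : 0 ≤ μ) (hβ0 : 0 ≤ β) (hρ0 : 0 ≤ ρ) (hδ₂0 : 0 ≤ δ₂)
    (hβ : ∀ u v, |Bf u v| ≤ β * p u * p v) (hRf : ∀ v, Lf (Rf v) = v) (hρ : ∀ v, p (Rf v) ≤ ρ * q v)
    {w : E} {y : V} (hLw : L w = y) (hδ₂ : q (L w - Lf w) ≤ δ₂ * p w) (hK : p w ≤ K * r)
    {A ℓ : ℝ} (hδ₁ : Bf w w - δ₁ * p w ^ 2 ≤ A) (hμ : ℓ ≤ μ * p w ^ 2)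
    {m : ℝ} (hm : ∀ w', Lf w' = y → m ≤ Bf w' w') :
    m - (δ₁ + μ + β * (ρ * δ₂) * (2 + ρ * δ₂)) * K ^ 2 * r ^ 2 ≤ A - ℓ := by
  have h := lagrangeHessian_ge_flatMin_sub_seminorm p q Bf L Lf hβ0 hρ0 hβ hRf hρ hLw hδ₂ hδ₁ hμ hm
  have hC : 0 ≤ δ₁ + μ + β * (ρ * δ₂) * (2 + ρ * δ₂) := by positivity
  have hw2 : p w ^ 2 ≤ K ^ 2 * r ^ 2 := by
    have h1 : p w ^ 2 ≤ (K * r) ^ 2 := pow_le_pow_left₀ (apply_nonneg p _) hK 2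
    calc p w ^ 2 ≤ (K * r) ^ 2 := h1
      _ = K ^ 2 * r ^ 2 := by ring
  have h2 : (δ₁ + μ + β * (ρ * δ₂) * (2 + ρ * δ₂)) * p w ^ 2
      ≤ (δ₁ + μ + β * (ρ * δ₂) * (2 + ρ * δ₂)) * (K ^ 2 * r ^ 2) := mul_le_mul_of_nonneg_left hw2 hC
  have h3 : (δ₁ + μ + β * (ρ * δ₂) * (2 + ρ * δ₂)) * (K ^ 2 * r ^ 2)
      = (δ₁ + μ + β * (ρ * δ₂) * (2 + ρ * δ₂)) * K ^ 2 * r ^ 2 := by ring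
  linarith

/-- **LETTER (μ)'s MULTIPLIER BOUND, SEMINORM SIZES**: `φ = λ₀ ∘ L`, `L(Rv) = v`, `|φ x| ≤ j·p(x)`, `p(Rv) ≤ ρ·q(v)` ⇒ `|λ₀ v| ≤ jρ·q(v)`.
[cite: Balaban1989LargeFieldII, (1.12) p.359; Balaban1985Variational, (82)–(83) p.290] -/
theorem abs_multiplier_apply_le_seminorm (p : Seminorm ℝ E) (q : V → ℝ) (φ : E →L[ℝ] ℝ) (L : E →L[ℝ] V) {R : V → E}
    (hR : ∀ v, L (R v) = v) {lam : V →L[ℝ] ℝ} (hlam : φ = lam.comp L) {j ρ : ℝ} (hj0 : 0 ≤ j) (hj : ∀ x, |φ x| ≤ j * p x)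
    (hρ : ∀ v, p (R v) ≤ ρ * q v) (v : V) : |lam v| ≤ j * ρ * q v := by
  have h1 : lam v = φ (R v) := by rw [hlam, ContinuousLinearMap.comp_apply, hR]
  rw [h1]
  calc |φ (R v)| ≤ j * p (R v) := hj _
    _ ≤ j * (ρ * q v) := mul_le_mul_of_nonneg_left (hρ v) hj0
    _ = j * ρ * q v := by ring

end Algebra

/-! ## §2  Polarisation for a seminorm -/

section Polarisation

variable {E : Type*} [NormedAddCommGroup E] [NormedSpace ℝ E]

/-- Bookkeeping: a real number below `c∕t²` for every `t > 0` (`c ≥ 0`) is `≤ 0`. [cite: Balaban1989LargeFieldII, (1.7) p.358 (bookkeeping)] -/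
theorem le_zero_of_forall_le_div_sq {x c : ℝ} (hc : 0 ≤ c) (h : ∀ t : ℝ, 0 < t → x ≤ c / t ^ 2) : x ≤ 0 := by
  by_contra hx
  have hx' : 0 < x := lt_of_not_ge hx
  set t := c / x + 1 with ht
  have ht1 : 1 ≤ t := by
    have := div_nonneg hc hx'.le
    rw [ht]
    linarith
  have ht0 : 0 < t := by linarith
  have h1 := h t ht0
  have h2 : c / t ^ 2 ≤ c / t := by
    apply div_le_div_of_nonneg_left hc ht0
    nlinarith
  have h3 : c / t < x := by
    rw [div_lt_iff₀ ht0, ht]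
    have : x * (c / x + 1) = c + x := by field_simp
    linarith
  linarith

/-- ★ **POLARISATION FOR A SEMINORM**: a SYMMETRIC bilinear form with a diagonal bound `|B(w,w)| ≤ β′·p(w)²` in a seminorm `p` (e.g. dag-n12-w2's
`|Q_U(X)| ≤ 8(d−1)·Σ_b‖X_b‖²` — the square of the `ℓ²` seminorm of the bond-field Pi type) satisfies `|B(u,v)| ≤ 2β′·p(u)·p(v)` — DEGENERATE directions
included (`p(u) = 0` forces `B(u,·) = 0`: scale `u ↦ tu`, `v ↦ t⁻¹v` and let `t → ∞`). [cite: Balaban1985BackgroundPropagators, (3.10) p.392; Balaban1989LargeFieldII, (1.7) p.358 (bookkeeping)] -/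
theorem abs_bilin_le_of_symm_of_diag_seminorm (p : Seminorm ℝ E) (B : E →L[ℝ] E →L[ℝ] ℝ) (hsym : ∀ u v, B u v = B v u) {β' : ℝ}
    (hβ' : 0 ≤ β') (hdiag : ∀ w, |B w w| ≤ β' * p w ^ 2) (u v : E) : |B u v| ≤ 2 * β' * p u * p v := by
  -- polarisation at general vectors
  have hpol : ∀ a b : E, |B a b| ≤ β' * (p a + p b) ^ 2 / 2 := by
    intro a b
    have h4 : 4 * B a b = B (a + b) (a + b) - B (a - b) (a - b) := by
      simp only [map_add, map_sub, add_apply, sub_apply, hsym b a]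
      ring
    have hsq1 : p (a + b) ^ 2 ≤ (p a + p b) ^ 2 := pow_le_pow_left₀ (apply_nonneg p _) (map_add_le_add p a b) 2
    have hsq2 : p (a - b) ^ 2 ≤ (p a + p b) ^ 2 := pow_le_pow_left₀ (apply_nonneg p _) (map_sub_le_add p a b) 2
    have h1 := (hdiag (a + b)).trans (mul_le_mul_of_nonneg_left hsq1 hβ')
    have h2 := (hdiag (a - b)).trans (mul_le_mul_of_nonneg_left hsq2 hβ')
    have h3 : |4 * B a b| ≤ β' * (p a + p b) ^ 2 + β' * (p a + p b) ^ 2 := by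
      rw [h4]
      exact (abs_sub _ _).trans (add_le_add h1 h2)
    rw [abs_mul, abs_of_pos (by norm_num : (0 : ℝ) < 4)] at h3
    linarith
  -- scaling: `B u v = B (t•u) (t⁻¹•v)` for `t ≠ 0`
  have hscale : ∀ t : ℝ, 0 < t → |B u v| ≤ β' * (t * p u + t⁻¹ * p v) ^ 2 / 2 := by
    intro t ht
    have ht0 : t ≠ 0 := ht.ne'
    have hrepr : B (t • u) (t⁻¹ • v) = B u v := by
      simp only [map_smul, smul_eq_mul, FunLike.coe_smul, Pi.smul_apply]
      field_simp
    have hb := hpol (t • u) (t⁻¹ • v)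
    rw [hrepr, map_smul_eq_mul p, map_smul_eq_mul p, Real.norm_eq_abs, Real.norm_eq_abs, abs_of_pos ht,
      abs_of_pos (inv_pos.mpr ht)] at hb
    exact hb
  have hpu : 0 ≤ p u := apply_nonneg p u
  have hpv : 0 ≤ p v := apply_nonneg p v
  by_cases hu : p u = 0
  · -- degenerate direction: `|B u v| ≤ β′ p(v)² ∕ (2t²)` for all `t > 0`
    have h0 : |B u v| ≤ 0 := by
      refine le_zero_of_forall_le_div_sq (c := β' * p v ^ 2 / 2) (by positivity) fun t ht => ?_
      have h := hscale t ht
      rw [hu, mul_zero, zero_add] at h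
      calc |B u v| ≤ β' * (t⁻¹ * p v) ^ 2 / 2 := h
        _ = β' * p v ^ 2 / 2 / t ^ 2 := by field_simp
    rw [hu]
    simpa using h0
  by_cases hv : p v = 0
  · have h0 : |B u v| ≤ 0 := by
      refine le_zero_of_forall_le_div_sq (c := β' * p u ^ 2 / 2) (by positivity) fun t ht => ?_
      have h := hscale t⁻¹ (inv_pos.mpr ht)
      rw [hv, mul_zero, add_zero] at h
      calc |B u v| ≤ β' * (t⁻¹ * p u) ^ 2 / 2 := h
        _ = β' * p u ^ 2 / 2 / t ^ 2 := by field_simp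
    rw [hv]
    simpa using h0
  -- both sizes positive: normalise to size one
  have hup : 0 < p u := lt_of_le_of_ne hpu (Ne.symm hu)
  have hvp : 0 < p v := lt_of_le_of_ne hpv (Ne.symm hv)
  have hb := hpol ((p u)⁻¹ • u) ((p v)⁻¹ • v)
  rw [map_smul_eq_mul p, map_smul_eq_mul p, Real.norm_eq_abs, Real.norm_eq_abs, abs_of_pos (inv_pos.mpr hup), abs_of_pos (inv_pos.mpr hvp),
    inv_mul_cancel₀ hup.ne', inv_mul_cancel₀ hvp.ne'] at hb
  have hb' : |B ((p u)⁻¹ • u) ((p v)⁻¹ • v)| ≤ 2 * β' := by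
    have : β' * (1 + 1 : ℝ) ^ 2 / 2 = 2 * β' := by ring
    linarith
  have hrepr : B u v = p u * p v * B ((p u)⁻¹ • u) ((p v)⁻¹ • v) := by
    have h1 : B ((p u)⁻¹ • u) ((p v)⁻¹ • v) = (p u)⁻¹ * ((p v)⁻¹ * B u v) := by
      simp only [map_smul, smul_eq_mul, FunLike.coe_smul, Pi.smul_apply]
      ring
    rw [h1, show p u * p v * ((p u)⁻¹ * ((p v)⁻¹ * B u v)) = (p u * (p u)⁻¹) * (p v * (p v)⁻¹) * B u v by ring,
      mul_inv_cancel₀ hup.ne', mul_inv_cancel₀ hvp.ne', one_mul, one_mul]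
  rw [hrepr, abs_mul, abs_mul, abs_of_pos hup, abs_of_pos hvp]
  have := mul_le_mul_of_nonneg_left hb' (mul_nonneg hup.le hvp.le)
  linarith

end Polarisation

/-! ## §3  The value Hessian along a critical family, seminorm sizes (dag-n12-w3's (1.12) shape) -/

section ValueHessian

variable {E V G : Type*} [NormedAddCommGroup E] [NormedSpace ℝ E]
  [NormedAddCommGroup V] [NormedSpace ℝ V]
  [NormedAddCommGroup G] [NormedSpace ℝ G]

/-- ★★ **THE VALUE HESSIAN AT THE NEAR-FLAT BACKGROUND DOMINATES THE FLAT EFFECTIVE FORM — SEMINORM SIZES.**  dag-n12-w3's `hessian_value_criticalFamily`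
(the calculus stays on the instance norms of `E`, `V`, `G`) + an affine datum (`λ₀(D²(Φ∘γ)(g₀)[h,h]) = 0`) + the letters of
`lagrangeHessian_ge_flatMin_sub_seminorm` at `w := γ′h` measured by a seminorm `p` on `E` and a size `q` on `V`:
`m − (δ₁ + μ + βρδ₂(2 + ρδ₂))·p(γ′h)² ≤ D²(a∘γ)(g₀)[h,h]`. [cite: Balaban1989LargeFieldII, (1.7) pp.357–358, (1.12) p.359; Balaban1985Variational, (174)–(177) pp.305–306] -/
theorem hessian_value_criticalFamily_ge_flatMin_sub_seminorm {a : E → ℝ} {Φ : E → V} {γ : G → E} {g₀ : G} {x₀ : E}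
    (hγ₀ : γ g₀ = x₀) {γ' : G →L[ℝ] E} (hγ : HasFDerivAt γ γ' g₀) {γ₂ : G →L[ℝ] G →L[ℝ] E}
    (hγ₂ : HasFDerivAt (fun g => fderiv ℝ γ g) γ₂ g₀) (hγd : ∀ᶠ g in 𝓝 g₀, DifferentiableAt ℝ γ g)
    {a₂ : E →L[ℝ] E →L[ℝ] ℝ} (ha₂ : HasFDerivAt (fun x => fderiv ℝ a x) a₂ x₀) (had : ∀ᶠ x in 𝓝 x₀, DifferentiableAt ℝ a x)
    {Φ₂ : E →L[ℝ] E →L[ℝ] V} (hΦ₂ : HasFDerivAt (fun x => fderiv ℝ Φ x) Φ₂ x₀) (hΦd : ∀ᶠ x in 𝓝 x₀, DifferentiableAt ℝ Φ x)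
    {lam : V →L[ℝ] ℝ} (hlam : fderiv ℝ a x₀ = lam.comp (fderiv ℝ Φ x₀)) (h : G)
    (haff : lam (fderiv ℝ (fun g => fderiv ℝ (fun g => Φ (γ g)) g) g₀ h h) = 0)
    (p : Seminorm ℝ E) (q : V → ℝ) (Bf : E →L[ℝ] E →L[ℝ] ℝ) (Lf : E →L[ℝ] V) {Rf : V → E} {δ₁ μ β ρ δ₂ : ℝ}
    (hβ0 : 0 ≤ β) (hρ0 : 0 ≤ ρ) (hβ : ∀ u v, |Bf u v| ≤ β * p u * p v) (hRf : ∀ v, Lf (Rf v) = v) (hρ : ∀ v, p (Rf v) ≤ ρ * q v)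
    (hδ₂ : q (fderiv ℝ Φ x₀ (γ' h) - Lf (γ' h)) ≤ δ₂ * p (γ' h))
    (hδ₁ : Bf (γ' h) (γ' h) - δ₁ * p (γ' h) ^ 2 ≤ a₂ (γ' h) (γ' h))
    (hμ : lam (Φ₂ (γ' h) (γ' h)) ≤ μ * p (γ' h) ^ 2)
    {m : ℝ} (hm : ∀ w', Lf w' = fderiv ℝ Φ x₀ (γ' h) → m ≤ Bf w' w') :
    m - (δ₁ + μ + β * (ρ * δ₂) * (2 + ρ * δ₂)) * p (γ' h) ^ 2
      ≤ fderiv ℝ (fun g => fderiv ℝ (fun g => a (γ g)) g) g₀ h h := by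
  rw [hessian_value_criticalFamily hγ₀ hγ hγ₂ hγd ha₂ had hΦ₂ hΦd hlam h h, haff, add_zero]
  exact lagrangeHessian_ge_flatMin_sub_seminorm p q Bf (fderiv ℝ Φ x₀) Lf hβ0 hρ0 hβ hRf hρ rfl hδ₂ hδ₁ hμ hm

/-- **THE SAME FOR THE IMPLICIT FAMILY PARAMETRISED BY ITS DATUM** (`G = V`, `Φ(γ g) = g` near `g₀` — dag-n12-w1's `exists_criticalFamily` output; then the
affine-datum hypothesis holds by `B16Ineq17NearFlatOneSidedDatum.fderiv_fderiv_datum_eq_zero_of_section`, whose three-line proof is repeated here to keep this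
file's imports to the prequel). [cite: Balaban1989LargeFieldII, (1.7) pp.357–358, (1.12) p.359; Balaban1985Variational, (172)–(177) pp.305–306] -/
theorem hessian_value_criticalFamily_ge_flatMin_sub_seminorm_of_section {a : E → ℝ} {Φ : E → V} {γ : V → E} {g₀ : V} {x₀ : E}
    (hγ₀ : γ g₀ = x₀) {γ' : V →L[ℝ] E} (hγ : HasFDerivAt γ γ' g₀) {γ₂ : V →L[ℝ] V →L[ℝ] E}
    (hγ₂ : HasFDerivAt (fun g => fderiv ℝ γ g) γ₂ g₀) (hγd : ∀ᶠ g in 𝓝 g₀, DifferentiableAt ℝ γ g)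
    {a₂ : E →L[ℝ] E →L[ℝ] ℝ} (ha₂ : HasFDerivAt (fun x => fderiv ℝ a x) a₂ x₀) (had : ∀ᶠ x in 𝓝 x₀, DifferentiableAt ℝ a x)
    {Φ₂ : E →L[ℝ] E →L[ℝ] V} (hΦ₂ : HasFDerivAt (fun x => fderiv ℝ Φ x) Φ₂ x₀) (hΦd : ∀ᶠ x in 𝓝 x₀, DifferentiableAt ℝ Φ x)
    {lam : V →L[ℝ] ℝ} (hlam : fderiv ℝ a x₀ = lam.comp (fderiv ℝ Φ x₀)) (h : V)
    (hsec : ∀ᶠ g in 𝓝 g₀, Φ (γ g) = g)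
    (p : Seminorm ℝ E) (q : V → ℝ) (Bf : E →L[ℝ] E →L[ℝ] ℝ) (Lf : E →L[ℝ] V) {Rf : V → E} {δ₁ μ β ρ δ₂ : ℝ}
    (hβ0 : 0 ≤ β) (hρ0 : 0 ≤ ρ) (hβ : ∀ u v, |Bf u v| ≤ β * p u * p v) (hRf : ∀ v, Lf (Rf v) = v) (hρ : ∀ v, p (Rf v) ≤ ρ * q v)
    (hδ₂ : q (fderiv ℝ Φ x₀ (γ' h) - Lf (γ' h)) ≤ δ₂ * p (γ' h))
    (hδ₁ : Bf (γ' h) (γ' h) - δ₁ * p (γ' h) ^ 2 ≤ a₂ (γ' h) (γ' h))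
    (hμ : lam (Φ₂ (γ' h) (γ' h)) ≤ μ * p (γ' h) ^ 2)
    {m : ℝ} (hm : ∀ w', Lf w' = fderiv ℝ Φ x₀ (γ' h) → m ≤ Bf w' w') :
    m - (δ₁ + μ + β * (ρ * δ₂) * (2 + ρ * δ₂)) * p (γ' h) ^ 2
      ≤ fderiv ℝ (fun g => fderiv ℝ (fun g => a (γ g)) g) g₀ h h := by
  -- the section identity makes the datum map eventually the identity, so its second derivative vanishes
  have haff0 : fderiv ℝ (fun g => fderiv ℝ (fun g => Φ (γ g)) g) g₀ h h = 0 := by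
    obtain ⟨s, hs, hso, hg₀⟩ := mem_nhds_iff.mp hsec
    have hloc : (fun g => fderiv ℝ (fun g => Φ (γ g)) g) =ᶠ[𝓝 g₀] fun _ => ContinuousLinearMap.id ℝ V := by
      filter_upwards [hso.mem_nhds hg₀] with g hg
      have heq : (fun g => Φ (γ g)) =ᶠ[𝓝 g] fun g => g :=
        Filter.eventually_of_mem (hso.mem_nhds hg) fun g' hg' => hs hg'
      rw [heq.fderiv_eq]
      exact fderiv_id
    rw [hloc.fderiv_eq, (hasFDerivAt_const (ContinuousLinearMap.id ℝ V) g₀).fderiv, zero_apply, zero_apply]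
  exact hessian_value_criticalFamily_ge_flatMin_sub_seminorm hγ₀ hγ hγ₂ hγd ha₂ had hΦ₂ hΦd hlam h (by rw [haff0, map_zero])
    p q Bf Lf hβ0 hρ0 hβ hRf hρ hδ₂ hδ₁ hμ hm

end ValueHessian

end Literature.MathematicalPhysics.QuantumFieldTheory.Balaban1983to89.B16Ineq17NearFlatOneSidedSeminorm

end
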